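import Literature.Barriers.AtomisticToContinuum.DisorderedHarmonicChainPhasesProofs
import Mathlib.MeasureTheory.Constructions.Pi
import Mathlib.MeasureTheory.Integral.Prod
import HarnessLib

/-!
# Ajanki–Huveneers 2011, §3/§6: restarting the phase chain, and the deterministic initial phase

Theorems-only sibling of `DisorderedHarmonicChainPhases.lean` (provefact unit
`AjankiHuveneers2011_spectralScaling`, inputs of the derivation of the low-frequency bound (U) of
`…Transfer.lean` along §6.2 of the paper):

* the Markov/restart structure used in (6.6): `X^x_{r+k}(B) = X^{X^x_r}_k(θ_r B)` (`ahPhase_add`)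
  and the corresponding factorisation of the amplitude,
  `Γ^x_n = Γ^x_r · φ_r · Γ^{X_r}_{n-r}(θ_r B)` with `φ_r` the factor at the restart point
  (`ahGamma_restart`; "`Γ^ϑ_n = Γ^ϑ_{n-m} ∏_{l=n-m+1}^n g(X^ϑ_{l-1}, B_l)`", §6.2);
* the deterministic control of the phase during the first `𝒪(1/w)` steps from Cor. 3.4 (i):
  `l((1+b₋)w - Cw²) ≤ X^x_l - x ≤ l((1+b₊)w + Cw²)` (`ahPhase_sub_start_bounds`), used for the
  term `𝒥₁` of (6.4) ("`wn ≲ X_n ≤ ½wn ≤ ½`", (6.5)) and to keep the representation of Cor. 3.6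
  non-degenerate before the potential theory of Prop. 5.1 takes over;
* `X_{l+1} - ϑ = X_l + Φ(X_l, B_{l+1})` (`ahPhase_succ_sub_theta`): the denominators of the
  product formula of Cor. 3.6 are `sin π(X_{l+1} - ϑ)`;
* joining two blocks of i.i.d. disorder: `Fin.append : ℝ^r × ℝ^L → ℝ^{r+L}` is measure
  preserving for the product laws (`measurePreserving_append`), whence Fubini at the restart
  time (`integral_pi_append`, the conditioning (6.6) of the paper as an iterated integral)
  and the null-set criterion `measure_pi_append_null`; the chain and amplitude of the joined
  configuration are the restarted ones (`ahPhase_append_left/right`, `ahGamma_append`).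

Source: O. Ajanki, F. Huveneers, CMP 301 (2011) 841–883, arXiv:1003.1076, Def. 3.3, Cor. 3.4,
Prop. 3.5 (3.14), §6.2 (6.5)–(6.6).
-/

noncomputable section

open Real Finset MeasureTheory

namespace Literature.Barriers.AtomisticToContinuum.HeatConduction

/-- `X_{l+1} - ϑ = X_l + Φ(X_l, B_{l+1})`. [cite: AjankiHuveneers2011, Def. 3.3 and Lemma 3.2 eq. (3.8)] -/
theorem ahPhase_succ_sub_theta (w x : ℝ) (B : ℕ → ℝ) (l : ℕ) :
    ahPhase w x B (l + 1) - ahTheta w = ahPhase w x B l + ahPhi w (ahPhase w x B l) (B l) := by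
  rw [ahPhase_succ, ahStep]
  ring

/-- **Restart (Markov structure of the lifted chain)**: `X^x_{r+k}(B) = X^{X^x_r(B)}_k(θ_r B)` with
`(θ_r B)_j = B_{r+j}`. [cite: AjankiHuveneers2011, Def. 3.3 (and §6.2 eq. (6.6))] -/
theorem ahPhase_add (w x : ℝ) (B : ℕ → ℝ) (r : ℕ) :
    ∀ k, ahPhase w x B (r + k) = ahPhase w (ahPhase w x B r) (fun j => B (r + j)) k
  | 0 => by simp
  | k + 1 => by
    rw [← add_assoc, ahPhase_succ, ahPhase_add w x B r k, ahPhase_succ]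

/-- **Factorisation of the amplitude at a restart time** `1 ≤ r < n`:
`Γ^x_n(B) = Γ^x_r(B) · φ_r · Γ^{X_r}_{n-r}(θ_r B)`, `φ_r = sin πX_r / sin π(X_r + Φ(X_r, B_{r+1}))` the
factor at the restart point (the `l' = 0` factor of the restarted chain, which `Γ^{X_r}_{n-r}` does
not contain). [cite: AjankiHuveneers2011, Prop. 3.5 eq. (3.14) and §6.2 (before eq. (6.7))] -/
theorem ahGamma_restart (w x : ℝ) (B : ℕ → ℝ) {r n : ℕ} (hr : 1 ≤ r) (hrn : r < n) :
    ahGamma w x B n = ahGamma w x B r * ahFactor w (ahPhase w x B r) (B r) *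
      ahGamma w (ahPhase w x B r) (fun j => B (r + j)) (n - r) := by
  unfold ahGamma
  rw [← Finset.prod_Ico_consecutive _ hr hrn.le, Finset.prod_eq_prod_Ico_succ_bot hrn, mul_assoc]
  congr 2
  have h : ∏ l ∈ Ico (r + 1) n, ahFactor w (ahPhase w x B l) (B l) =
      ∏ k ∈ Ico 1 (n - r), ahFactor w (ahPhase w x B (r + k)) (B (r + k)) := by
    have h1 := Finset.prod_Ico_add' (fun l => ahFactor w (ahPhase w x B l) (B l)) 1 (n - r) r
    rw [show 1 + r = r + 1 by omega, show n - r + r = n by omega] at h1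
    rw [← h1]
    refine Finset.prod_congr rfl fun k _ => ?_
    rw [add_comm k r]
  rw [h]
  refine Finset.prod_congr rfl fun k _ => ?_
  rw [ahPhase_add w x B r k]

/-- **Deterministic control of the phase** (Cor. 3.4 (i) summed): for `-1 < b₋ ≤ 0 ≤ b₊` there are
`w₀ > 0`, `C` such that for `0 < w ≤ w₀`, all `x`, all `B ∈ [b₋, b₊]^ℕ` and all `l`,
`l((1+b₋)w - Cw²) ≤ X^x_l - x ≤ l((1+b₊)w + Cw²)`, with `(1+b₋)w - Cw² > 0`.
[cite: AjankiHuveneers2011, Cor. 3.4 (i) and §6.2 eq. (6.5)] -/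
theorem ahPhase_sub_start_bounds (bm bp : ℝ) (hbm : -1 < bm) (hbm0 : bm ≤ 0) (hbp : 0 ≤ bp) :
    ∃ w₀ : ℝ, 0 < w₀ ∧ ∃ C : ℝ, ∀ w ∈ Set.Ioc 0 w₀, 0 < (1 + bm) * w - C * w ^ 2 ∧
      ∀ x : ℝ, ∀ B : ℕ → ℝ, (∀ k, B k ∈ Set.Icc bm bp) → ∀ l : ℕ,
        l * ((1 + bm) * w - C * w ^ 2) ≤ ahPhase w x B l - x ∧
          ahPhase w x B l - x ≤ l * ((1 + bp) * w + C * w ^ 2) := by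
  obtain ⟨w₀, hw₀, C', hC'⟩ := ahStep_increment_bounds bm bp hbm hbm0 hbp
  obtain ⟨C, hCdef⟩ : ∃ C : ℝ, C = max C' 0 := ⟨_, rfl⟩
  have hC0 : 0 ≤ C := hCdef ▸ le_max_right _ _
  have hCC : C' ≤ C := hCdef ▸ le_max_left _ _
  have h1bm : 0 < 1 + bm := by linarith
  refine ⟨min w₀ ((1 + bm) / (2 * (C + 1))), by positivity, C, ?_⟩
  intro w hw
  obtain ⟨hw0, hw1⟩ := hw
  have hwa : w ≤ w₀ := hw1.trans (min_le_left _ _)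
  have hwb : w ≤ (1 + bm) / (2 * (C + 1)) := hw1.trans (min_le_right _ _)
  have hCw : C * w ≤ (1 + bm) / 2 := by
    calc C * w ≤ (C + 1) * w := by nlinarith
      _ ≤ (C + 1) * ((1 + bm) / (2 * (C + 1))) := mul_le_mul_of_nonneg_left hwb (by positivity)
      _ = (1 + bm) / 2 := by field_simp
  have hpos : 0 < (1 + bm) * w - C * w ^ 2 := by nlinarith
  refine ⟨hpos, ?_⟩
  intro x B hB l
  have hstep : ∀ k, (1 + bm) * w - C * w ^ 2 ≤ ahPhase w x B (k + 1) - ahPhase w x B k ∧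
      ahPhase w x B (k + 1) - ahPhase w x B k ≤ (1 + bp) * w + C * w ^ 2 := by
    intro k
    obtain ⟨-, h2, h3⟩ := hC' w ⟨hw0, hwa⟩ (ahPhase w x B k) (B k) (hB k)
    rw [ahPhase_succ]
    have : C' * w ^ 2 ≤ C * w ^ 2 := mul_le_mul_of_nonneg_right hCC (sq_nonneg w)
    exact ⟨by linarith, by linarith⟩
  induction l with
  | zero => simp
  | succ k ih =>
    obtain ⟨h1, h2⟩ := hstep k
    push_cast
    constructor <;> nlinarith [ih.1, ih.2]

/-! ### Dependence on finitely many coordinates; joining two blocks of disorder -/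

/-- `X^x_k` only reads `B_1, …, B_k`. [folklore] -/
theorem ahPhase_congr (w x : ℝ) {B B' : ℕ → ℝ} :
    ∀ k, (∀ j, j < k → B j = B' j) → ahPhase w x B k = ahPhase w x B' k
  | 0 => fun _ => rfl
  | k + 1 => fun h => by
    rw [ahPhase_succ, ahPhase_succ, ahPhase_congr w x k (fun j hj => h j (by omega)), h k (by omega)]

/-- `Γ^x_n` only reads `B_1, …, B_{n-1}` (indices `< n`). [folklore] -/
theorem ahGamma_congr (w x : ℝ) {B B' : ℕ → ℝ} (n : ℕ) (h : ∀ j, j < n → B j = B' j) :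
    ahGamma w x B n = ahGamma w x B' n := by
  unfold ahGamma
  refine Finset.prod_congr rfl fun l hl => ?_
  have hl' : l < n := (Finset.mem_Ico.mp hl).2
  rw [ahPhase_congr w x l (fun j hj => h j (by omega)), h l hl']

/-- The first block of `Fin.append β β'`. [folklore] -/
theorem finExt_append_of_lt {r L : ℕ} (β : Fin r → ℝ) (β' : Fin L → ℝ) {j : ℕ} (hj : j < r) :
    finExt (Fin.append β β') j = finExt β j := by
  rw [finExt_of_lt _ (by omega : j < r + L), finExt_of_lt _ hj]
  exact Fin.append_left β β' ⟨j, hj⟩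

/-- The second block of `Fin.append β β'`. [folklore] -/
theorem finExt_append_add {r L : ℕ} (β : Fin r → ℝ) (β' : Fin L → ℝ) (j : ℕ) :
    finExt (Fin.append β β') (r + j) = finExt β' j := by
  by_cases hj : j < L
  · rw [finExt_of_lt _ (by omega : r + j < r + L), finExt_of_lt _ hj]
    exact Fin.append_right β β' ⟨j, hj⟩
  · simp [finExt, hj]

/-- Before the restart time the chain driven by `Fin.append β β'` is the chain driven by `β`. [folklore] -/
theorem ahPhase_append_left (w x : ℝ) {r L : ℕ} (β : Fin r → ℝ) (β' : Fin L → ℝ) {k : ℕ}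
    (hk : k ≤ r) : ahPhase w x (finExt (Fin.append β β')) k = ahPhase w x (finExt β) k :=
  ahPhase_congr w x k fun j hj => finExt_append_of_lt β β' (by omega)

/-- After the restart time `r` the chain driven by `Fin.append β β'` is the chain restarted at
`X_r(β)` and driven by `β'`. [cite: AjankiHuveneers2011, §6.2 eq. (6.6)] -/
theorem ahPhase_append_right (w x : ℝ) {r L : ℕ} (β : Fin r → ℝ) (β' : Fin L → ℝ) (k : ℕ) :
    ahPhase w x (finExt (Fin.append β β')) (r + k) =
      ahPhase w (ahPhase w x (finExt β) r) (finExt β') k := by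
  rw [ahPhase_add, ahPhase_append_left w x β β' le_rfl]
  exact ahPhase_congr w _ k fun j _ => finExt_append_add β β' j

/-- The amplitude up to the restart time only reads the first block. [folklore] -/
theorem ahGamma_append_left (w x : ℝ) {r L : ℕ} (β : Fin r → ℝ) (β' : Fin L → ℝ) :
    ahGamma w x (finExt (Fin.append β β')) r = ahGamma w x (finExt β) r :=
  ahGamma_congr w x r fun _ hj => finExt_append_of_lt β β' hj

/-- **Factorisation of the amplitude over two blocks of disorder** (`r, L ≥ 1`):
`Γ^x_{r+L}(β ⧺ β') = Γ^x_r(β) · φ(X_r(β), β'_0) · Γ^{X_r(β)}_L(β')`.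
[cite: AjankiHuveneers2011, Prop. 3.5 eq. (3.14) and §6.2 (before eq. (6.7))] -/
theorem ahGamma_append (w x : ℝ) {r L : ℕ} (β : Fin r → ℝ) (β' : Fin L → ℝ) (hr : 1 ≤ r)
    (hL : 1 ≤ L) :
    ahGamma w x (finExt (Fin.append β β')) (r + L) =
      ahGamma w x (finExt β) r * ahFactor w (ahPhase w x (finExt β) r) (finExt β' 0) *
        ahGamma w (ahPhase w x (finExt β) r) (finExt β') L := by
  rw [ahGamma_restart w x _ hr (by omega : r < r + L), Nat.add_sub_cancel_left,
    ahGamma_append_left, ahPhase_append_left w x β β' le_rfl,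
    show finExt (Fin.append β β') r = finExt β' 0 by simpa using finExt_append_add β β' 0]
  congr 1
  exact ahGamma_congr w _ L fun j _ => finExt_append_add β β' j

/-! ### Splitting the product measure at the restart time -/

section Split

variable (ρ : Measure ℝ) [IsProbabilityMeasure ρ]

/-- **Splitting `ρ^{⊗(r+L)}` into `ρ^{⊗r} ⊗ ρ^{⊗L}` along `Fin.append`**: the joining map is
measure preserving. [folklore] -/
theorem measurePreserving_append (r L : ℕ) :
    MeasurePreserving (fun p : (Fin r → ℝ) × (Fin L → ℝ) => Fin.append p.1 p.2)
      ((Measure.pi fun _ : Fin r => ρ).prod (Measure.pi fun _ : Fin L => ρ))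
      (Measure.pi fun _ : Fin (r + L) => ρ) := by
  set e : (Fin r → ℝ) × (Fin L → ℝ) ≃ᵐ (Fin (r + L) → ℝ) :=
    (MeasurableEquiv.sumPiEquivProdPi (fun _ : Fin r ⊕ Fin L => ℝ)).symm.trans
      (MeasurableEquiv.piCongrLeft (fun _ : Fin (r + L) => ℝ) finSumFinEquiv) with he_def
  have he : ∀ p : (Fin r → ℝ) × (Fin L → ℝ), e p = Fin.append p.1 p.2 := by
    intro p
    funext a
    obtain ⟨s, rfl⟩ := finSumFinEquiv.surjective a
    rw [he_def, MeasurableEquiv.trans_apply, MeasurableEquiv.coe_piCongrLeft,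
      Equiv.piCongrLeft_apply_apply]
    rcases s with i | i
    · rw [finSumFinEquiv_apply_left, Fin.append_left]; rfl
    · rw [finSumFinEquiv_apply_right, Fin.append_right]; rfl
  have h1 := measurePreserving_sumPiEquivProdPi_symm (fun _ : Fin r ⊕ Fin L => ρ)
  have h2 := measurePreserving_piCongrLeft (μ := fun _ : Fin (r + L) => ρ) finSumFinEquiv
  have h3 : MeasurePreserving e ((Measure.pi fun _ : Fin r => ρ).prod (Measure.pi fun _ : Fin L => ρ))
      (Measure.pi fun _ : Fin (r + L) => ρ) := h2.comp h1
  have hfun : (fun p : (Fin r → ℝ) × (Fin L → ℝ) => Fin.append p.1 p.2) = e := funext fun p => (he p).symm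
  rw [hfun]
  exact h3

/-- **Fubini at the restart time**: for an integrable `F`,
`∫ F dρ^{⊗(r+L)} = ∫∫ F(β ⧺ β') ρ^{⊗L}(dβ') ρ^{⊗r}(dβ)`.
[cite: AjankiHuveneers2011, §6.2 eq. (6.6)] -/
theorem integral_pi_append (r L : ℕ) (F : (Fin (r + L) → ℝ) → ℝ)
    (hF : Integrable F (Measure.pi fun _ : Fin (r + L) => ρ)) :
    ∫ B, F B ∂(Measure.pi fun _ : Fin (r + L) => ρ) =
      ∫ β, (∫ β', F (Fin.append β β') ∂(Measure.pi fun _ : Fin L => ρ))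
        ∂(Measure.pi fun _ : Fin r => ρ) := by
  have hmp := measurePreserving_append ρ r L
  have hemb : MeasurableEmbedding (fun p : (Fin r → ℝ) × (Fin L → ℝ) => Fin.append p.1 p.2) := by
    set e : (Fin r → ℝ) × (Fin L → ℝ) ≃ᵐ (Fin (r + L) → ℝ) :=
      (MeasurableEquiv.sumPiEquivProdPi (fun _ : Fin r ⊕ Fin L => ℝ)).symm.trans
        (MeasurableEquiv.piCongrLeft (fun _ : Fin (r + L) => ℝ) finSumFinEquiv) with he_def
    have he : ∀ p : (Fin r → ℝ) × (Fin L → ℝ), e p = Fin.append p.1 p.2 := by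
      intro p
      funext a
      obtain ⟨s, rfl⟩ := finSumFinEquiv.surjective a
      rw [he_def, MeasurableEquiv.trans_apply, MeasurableEquiv.coe_piCongrLeft,
        Equiv.piCongrLeft_apply_apply]
      rcases s with i | i
      · rw [finSumFinEquiv_apply_left, Fin.append_left]; rfl
      · rw [finSumFinEquiv_apply_right, Fin.append_right]; rfl
    have hfun : (fun p : (Fin r → ℝ) × (Fin L → ℝ) => Fin.append p.1 p.2) = e :=
      funext fun p => (he p).symm
    rw [hfun]
    exact e.measurableEmbedding
  rw [← hmp.integral_comp hemb F]
  exact integral_prod _ (hmp.integrable_comp_emb hemb |>.mpr hF)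

/-- **Null sets at the restart time**: a measurable set of disorder configurations is
`ρ^{⊗(r+L)}`-null as soon as all its sections after time `r` are `ρ^{⊗L}`-null. [folklore] -/
theorem measure_pi_append_null (r L : ℕ) {S : Set (Fin (r + L) → ℝ)} (hS : MeasurableSet S)
    (h : ∀ᵐ β ∂(Measure.pi fun _ : Fin r => ρ),
      (Measure.pi fun _ : Fin L => ρ) {β' | Fin.append β β' ∈ S} = 0) :
    (Measure.pi fun _ : Fin (r + L) => ρ) S = 0 := by
  have hmp := measurePreserving_append ρ r L
  rw [← hmp.measure_preimage hS.nullMeasurableSet]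
  rw [Measure.measure_prod_null (hS.preimage hmp.measurable)]
  filter_upwards [h] with β hβ
  simpa [Set.preimage] using hβ

end Split

end Literature.Barriers.AtomisticToContinuum.HeatConduction

end
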